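import Summits.BirchSwinnertonDyer.Rank1Residual.Additive.X3BranchMultCongruence
import Summits.BirchSwinnertonDyer.Rank1Residual.Additive.X3BranchAnalyticHalfGordDescent
import HarnessLib

/-!
# X3 on the semistable-twist locus, cell (M): TWIST DESCENT of the (M) face — `BSD(E,p)` on X3♯(M),
# `r_an = 0`, every odd `p`, from PRINT ∧ the displayed (M) branch congruence `hGVM` ∧ the
# `W`-LEVEL count `hAlgW` for `Sel_{p^∞}(E/ℚ_∞)` itself (cell `bsd-addord`, seat `bsd-addord-twist`;
# the (M) twin of `X3BranchAnalyticHalfGordDescent[EndState].lean`, planner ask T-M311)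

HONEST FRAMING (cell `bsd-addord`, `run/shared/lean/pub/bsd-addord/README.md` §4): the programme's
target of record is the full Birch–Swinnerton-Dyer formula for every `E/ℚ` of analytic rank `≤ 1`;
this file concerns the X3 rows of cell (M) of N10 only and books NOTHING: X3 stays
CONSTRUCTION-SHAPED. THEOREMS ONLY (no `def`, no named fact, no `sorry`). TWO inputs are NOT in print
and enter as DISPLAYED HYPOTHESES, never asserted: `hGVM` (Greenberg–Vatsal's Eisenstein congruence
on the `ω^{(p−1)/2}`-branch at a MULTIPLICATIVE prime — the SHAPE of the reading-fact p396718 with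
"good ordinary" replaced by "multiplicative"; outside GV's standing set-up "`K` unramified at all
primes dividing `N`", referee GAP(§4.2 P1/(M)), x3 R2) and `hAlgW` (GV's display (16) with (11) for
the ADDITIVE curve's own Selmer group over `ℚ_∞`, as in the (G-ord) descent file). PUBLISHED inputs
are explicit binders passed verbatim to additive-p1's consumers `ClassX3M.bsdp_rankZero_of_chiBranchLower[Odd]`
(`hW16` Wuthrich 2014 Thm. 16; `hDel98` / `hDelX` Delbourgo 1998 Prop. 4 and its exact (M) form; `hPal`
Pal 2012; `hGZK`; `hmod` / `hmodD`).

## Contents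

* §1 `X3Branch.charIdeal_eq_span_of_multBranchCongruence_of_count` — the (M) composition POINTWISE in
  the half-eigen datum (one `D`, branch series `B` of the telescope's reduction disjunction, count
  hypothesis for the generators of `char D.X`).
* §2 **`X3Branch.charIdeal_eq_span_of_multBranchCongruence_of_algebraicCountW`** — `V` MULTIPLICATIVE
  at the odd `p`, `C • V^{(p*)} = W`: for every `Λ`-dual datum `D` of `Sel_{p^∞}(W/ℚ_∞)` and every
  branch series `B` of the disjunction, `X(W/ℚ_∞)` is torsion and `char_Λ X(W/ℚ_∞) = (g')`,
  `ι g' = u·ϖ·B` — Delbourgo's Main Conjecture (M) of the additive `E` in Greenberg form — from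
  `hW16 ∧ hGVM ∧ hAlgW` (eigen-descent `SelmerDualData.exists_chiEigenInCyclotomic`, then §1).
* §3 `ClassX3M.chiBranchLowerLeadingTerm[Odd]At_of_multBranchCongruence_of_algebraicCountW` — the
  `T = 0` LOWER inputs on `W` (every twist model is multiplicative, additive-p1's
  `ClassX3M.mult_of_twist_model_pStar`, so the good-ordinary alternative of the defs is void; the
  constant term of the multiplicative branch is additive-p1's `exists_halfBranchMult_even/odd`);
  **`ClassX3M.bsdp_rankZero_of_multBranchCongruence_of_algebraicCountW`** — `BSD(E,p)` on X3♯(M) ∧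
  `r_an = 0` at EVERY odd `p` ⟸ PUBLISHED ∧ `hGVM` ∧ `hAlgW`.

KERNEL SENTENCE (no mark moved): on X3♯(M) ∧ `r_an = 0` ∧ branch parity, `BSD(E,p)` ⟸ PUBLISHED ∧
[GV's branch congruence at a multiplicative prime — OPEN, near-print] ∧ [GV (16)+(11) for
`Sel_{p^∞}(E/ℚ_∞)` — OPEN, the X2-devissage output shape]. Reach (seat census v2, `N < 5·10⁵`):
branch-parity non-degenerate (M) X3 classes 2 457 @3 + 190 @5 + 23 @7 = 2 670 (83 content).

## What this is NOT

Not a class theorem (two open inputs); not a Literature fact; not the (G-ord) cell (siblings, ONE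
open input there); not the degenerate `p = 3` rows; not rank `1`.

References: [GreenbergVatsal2000] §2 (11), (16), §3 pp. 38–39, Thm. (3.12) (shape only);
[Wuthrich2014] Thm. 16; [Delbourgo1998] Prop. 4, Main Conjecture p. 151; [Pal2012] Thm. 3.2;
[GreenbergLNM1716] §5 p. 143; [MazurTateTeitelbaum1986Invent] §I.13–I.14; [SilvermanATAEC1994] V.5.3.
-/

set_option autoImplicit false

noncomputable section

open scoped Classical MatrixGroups ModularForm

namespace Summit.BirchSwinnertonDyer.Rank1Residual.Additive

open CongruenceSubgroup WeierstrassCurve NumberField IsDedekindDomain Field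
  Literature.NumberTheory.EllipticCurves
  Literature.NumberTheory.EllipticCurves.ModularForms
  Literature.NumberTheory.EllipticCurves.GreenbergVatsal2000
  Literature.NumberTheory.EllipticCurves.Rank1Residual
  Literature.NumberTheory.EllipticCurves.Rank1Residual.Typed
  Literature.NumberTheory.GaloisRepresentations
  Summit.BirchSwinnertonDyer.Rank1Residual.X1.MuLambda
  Summit.BirchSwinnertonDyer.Rank1Residual.AdditivePotMult
  Summit.BirchSwinnertonDyer.Rank1Residual.Additive.X3Branch

/-! ### §1 Pointwise (M) composition -/

section Pointwise

variable {V : WeierstrassCurve ℚ} [V.IsElliptic] [V.IsGloballyMinimal]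
  {W : WeierstrassCurve ℚ} [W.IsElliptic] [W.IsGloballyMinimal] {p : ℕ} [hp : Fact p.Prime]

/-- **The (M) composition POINTWISE in the half-eigen datum**: `V` multiplicative at `p`,
`C • V^{(p*)} = W`, ONE telescope instance `(K, F, κ, γ, f, B)` with `B` in the reduction disjunction,
ONE half-eigen datum `D` with period ratio `ϖ`; if every generator `g` of `char D.X` with `μ(g) = 0`
has `p^{λ(g)+Σδ} = #H¹(ℚ_Σ/ℚ_∞, Φ₀)·#U` (`hcount`) then `D.X` is torsion and `char D.X = (g')` with
`ι g' = u·ϖ·B` — from `hW16` and the displayed `hGVM`. Same `Λ`-algebra as the sibling files.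
[cite: GreenbergVatsal2000, p. 4, §3 pp. 38–39 (shape only)] [cite: Wuthrich2014, Thm. 16 (p. 397)] -/
theorem X3Branch.charIdeal_eq_span_of_multBranchCongruence_of_count
    (hW16 : Wuthrich2014.thm16_halfEigenCharIdeal_dvd_cyclotomicPrime)
    (hGVM : ∀ (V : WeierstrassCurve ℚ) [V.IsGloballyMinimal] [V.IsElliptic]
      (W : WeierstrassCurve ℚ) [W.IsGloballyMinimal] [W.IsElliptic] (p : ℕ) [Fact p.Prime]
      (K : Type) [Field K] [NumberField K] [(galRange (K := ℚ) K).Normal]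
      (κ : ZpExtension ℚ p) {N : ℕ} [NeZero N] (f : CuspForm (Gamma0 N) 2) (B : PowerSeries ℚ_[p])
      (S₀ : Finset (HeightOneSpectrum (𝓞 ℚ)))
      (Φ₀ : AddSubgroup (W.geomTorsion (p : ℤ))) (hΦ : IsRationalLine W p Φ₀),
      p ≠ 2 → V.HasMultiplicativeReductionAtPrime p → ¬ V.HasIrreducibleModPGaloisRep p →
      Module.finrank ℚ K = 2 → (∃ θ : K, θ ^ 2 = algebraMap ℚ K ((-1) ^ (p / 2) * p)) →
      (∃ C : VariableChange ℚ, C • V.quadraticTwist ((-1) ^ (p / 2) * p : ℚ) = W) →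
      κ.IsCyclotomic →
      ((IsOrdinaryAt V p ∧
          B = if Even (p / 2) then padicLFunctionBranch f ((unitRoot V p : ℤ_[p]) : ℚ_[p]) (p / 2)
            else padicLFunctionMinusBranch f ((unitRoot V p : ℤ_[p]) : ℚ_[p]) (p / 2)) ∨
        (V.HasSplitMultiplicativeReductionAtPrime p ∧
          B = if Even (p / 2) then padicLFunctionPlusBranchMult f (1 : ℚ_[p]) (p / 2)
            else padicLFunctionMinusBranchMult f (1 : ℚ_[p]) (p / 2)) ∨
        (V.HasMultiplicativeReductionAtPrime p ∧ ¬ V.HasSplitMultiplicativeReductionAtPrime p ∧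
          B = if Even (p / 2) then padicLFunctionPlusBranchMult f (-1 : ℚ_[p]) (p / 2)
            else padicLFunctionMinusBranchMult f (-1 : ℚ_[p]) (p / 2))) →
      IsNewformOf V f → LineEven W p Φ₀ →
      (∃ (σ : absoluteGaloisGroup ℚ) (P : W.geomTorsion (p : ℤ)), P ∈ Φ₀ ∧ σ • P ≠ P) →
      (¬ ∀ v : HeightOneSpectrum (𝓞 ℚ), ((p : ℕ) : 𝓞 ℚ) ∈ v.asIdeal →
          ∀ 𝔓 ∈ v.primesAbove, ∀ σ ∈ 𝔓.inertia (absoluteGaloisGroup ℚ), ∀ P ∈ Φ₀,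
            σ • P = (if σ ∈ galRange (K := ℚ) K then P else -P)) →
      (∀ v ∈ S₀, ((p : ℕ) : 𝓞 ℚ) ∉ v.asIdeal) →
      (∀ v : HeightOneSpectrum (𝓞 ℚ), v ∉ S₀ → ((p : ℕ) : 𝓞 ℚ) ∉ v.asIdeal →
        W.HasGoodReductionAt v) →
      ∀ (ϖ : ℚ), (if Even (p / 2) then (ϖ : ℝ) * V.realPeriodRat = plusPeriod f
          else (ϖ : ℝ) * V.imaginaryPeriodRat = minusPeriod f) →
      ∀ (b : IwasawaAlgebra p) (u : ℤ_[p]ˣ),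
        iwasawaToPowerSeries p b = PowerSeries.C ((((u : ℤ_[p]) : ℚ_[p])) * ((ϖ : ℚ) : ℚ_[p])) * B →
        HasUnitContent (b * eulerFactorProduct W p S₀) ∧
          p ^ (PowerSeries.map (PadicInt.toZMod (p := p)) (b * eulerFactorProduct W p S₀)).order.toNat =
            Nat.card (residualLineH1 W p κ S₀ Φ₀ hΦ) * Nat.card (residualQuotSelmer W p κ S₀ Φ₀ hΦ))
    (hmult : Mult V p)
    (htw : ∃ C : VariableChange ℚ, C • V.quadraticTwist ((-1) ^ (p / 2) * p : ℚ) = W)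
    (S₀ : Finset (HeightOneSpectrum (𝓞 ℚ))) (hS₀ : ∀ v ∈ S₀, ((p : ℕ) : 𝓞 ℚ) ∉ v.asIdeal)
    (hS : ∀ v : HeightOneSpectrum (𝓞 ℚ), v ∉ S₀ → ((p : ℕ) : 𝓞 ℚ) ∉ v.asIdeal →
      W.HasGoodReductionAt v)
    (Φ₀ : AddSubgroup (W.geomTorsion (p : ℤ))) (hΦ : IsRationalLine W p Φ₀)
    (heven : LineEven W p Φ₀)
    (hnt : ∃ (σ : absoluteGaloisGroup ℚ) (P : W.geomTorsion (p : ℤ)), P ∈ Φ₀ ∧ σ • P ≠ P)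
    (K : Type) [Field K] [NumberField K] [(galRange (K := ℚ) K).Normal]
    (F : Type) [Field F] [NumberField F] [IsCyclotomicExtension {p} ℚ F]
    [(galRange (K := ℚ) F).Normal]
    {κ : ZpExtension ℚ p} {γ : Field.absoluteGaloisGroup ℚ} {N : ℕ} [NeZero N]
    {f : CuspForm (Gamma0 N) 2} {B : PowerSeries ℚ_[p]}
    (hp2 : p ≠ 2) (h2 : Module.finrank ℚ K = 2)
    (hθ : ∃ θ : K, θ ^ 2 = algebraMap ℚ K ((-1) ^ (p / 2) * p))
    (hred : ((IsOrdinaryAt V p ∧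
        B = if Even (p / 2) then padicLFunctionBranch f ((unitRoot V p : ℤ_[p]) : ℚ_[p]) (p / 2)
          else padicLFunctionMinusBranch f ((unitRoot V p : ℤ_[p]) : ℚ_[p]) (p / 2)) ∨
      (V.HasSplitMultiplicativeReductionAtPrime p ∧
        B = if Even (p / 2) then padicLFunctionPlusBranchMult f (1 : ℚ_[p]) (p / 2)
          else padicLFunctionMinusBranchMult f (1 : ℚ_[p]) (p / 2)) ∨
      (V.HasMultiplicativeReductionAtPrime p ∧ ¬ V.HasSplitMultiplicativeReductionAtPrime p ∧
        B = if Even (p / 2) then padicLFunctionPlusBranchMult f (-1 : ℚ_[p]) (p / 2)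
          else padicLFunctionMinusBranchMult f (-1 : ℚ_[p]) (p / 2))))
    (hramK : ¬ ∀ v : HeightOneSpectrum (𝓞 ℚ), ((p : ℕ) : 𝓞 ℚ) ∈ v.asIdeal →
        ∀ 𝔓 ∈ v.primesAbove, ∀ σ ∈ 𝔓.inertia (absoluteGaloisGroup ℚ), ∀ P ∈ Φ₀,
          σ • P = (if σ ∈ galRange (K := ℚ) K then P else -P))
    (hirr : ¬ V.HasIrreducibleModPGaloisRep p)
    (hκ : κ.IsCyclotomic) (hγ : κ.IsTopGenerator γ) (hcyc : IsCyclotomicVariable p γ)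
    (hγK : γ ∈ galRange (K := ℚ) K) (hγF : γ ∈ galRange (K := ℚ) F) (hf : IsNewformOf V f)
    (D : V.EigenSelmerDualData p
        (κ.kerSubgroup ⊓ galRange (K := ℚ) K ⊓ galRange (K := ℚ) F) κ.kerSubgroup
        (fun g ↦ if g ∈ galRange (K := ℚ) K then 1 else -1) γ)
    (ϖ : ℚ) (hϖ : if Even (p / 2) then (ϖ : ℝ) * V.realPeriodRat = plusPeriod f
        else (ϖ : ℝ) * V.imaginaryPeriodRat = minusPeriod f)
    (hcount : ∀ g : IwasawaAlgebra p, D.charIdeal = Ideal.span {g} → HasUnitContent g →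
      p ^ (lam g + ∑ v ∈ S₀, delta W p v) =
        Nat.card (residualLineH1 W p κ S₀ Φ₀ hΦ) * Nat.card (residualQuotSelmer W p κ S₀ Φ₀ hΦ)) :
    Module.IsTorsion (IwasawaAlgebra p) D.X ∧
      ∃ g' : IwasawaAlgebra p, D.charIdeal = Ideal.span {g'} ∧ ∃ u : ℤ_[p]ˣ,
        iwasawaToPowerSeries p g' = PowerSeries.C (((u : ℤ_[p]) : ℚ_[p]) * (ϖ : ℚ_[p])) * B := by
  obtain ⟨htors, g', hg'mem, u, hι⟩ :=
    hW16 p V K F B hp2 h2 hθ hred hirr hκ hγ hcyc hγK hγF hf D ϖ hϖ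
  refine ⟨htors, ?_⟩
  obtain ⟨g, hg⟩ := (charIdeal_isPrincipal_holds p D.X).principal
  have hchar : D.charIdeal = Ideal.span {g} := hg
  have hdvd : g ∣ g' := by
    rw [hchar] at hg'mem
    exact Ideal.mem_span_singleton.mp hg'mem
  obtain ⟨h, hfac⟩ := hdvd
  subst hfac
  obtain ⟨hu, hM⟩ := hGVM V W p K κ f B S₀ Φ₀ hΦ hp2 hmult hirr h2 hθ htw hκ hred hf heven hnt hramK
    hS₀ hS ϖ hϖ (g * h) u hι
  obtain ⟨hμan, hAn⟩ :=
    X3Branch.hasUnitContent_and_pow_lam_add_of_nonPrimitive_count W S₀ hp2 hS₀ hu hM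
  have hμalg : HasUnitContent g := X11a.hasUnitContent_left_of_mul hμan
  have hAl := hcount g hchar hμalg
  have hlam : lam (g * h) = lam g := by
    have hpow : p ^ (lam (g * h) + ∑ v ∈ S₀, delta W p v) = p ^ (lam g + ∑ v ∈ S₀, delta W p v) :=
      hAn.trans hAl.symm
    have := Nat.pow_right_injective hp.out.two_le hpow
    omega
  refine ⟨g * h, hchar.trans ?_, u, hι⟩
  exact (span_mul_eq_span_of_hasUnitContent_of_lam_le (X11a.ne_zero_of_hasUnitContent hμalg) hμan
    hlam.le).symm

end Pointwise

/-! ### §2 TWIST DESCENT on (M): the `W`-level branch main conjecture -/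

section Descent

variable {V : WeierstrassCurve ℚ} [V.IsElliptic] [V.IsGloballyMinimal]
  {W : WeierstrassCurve ℚ} [W.IsElliptic] [W.IsGloballyMinimal] {p : ℕ} [hp : Fact p.Prime]

/-- **Cell (M), `W`-level: Delbourgo's Main Conjecture (M) of the additive `E = W` in Greenberg form,
from PRINT ∧ `hGVM` ∧ `hAlgW`.** `V` MULTIPLICATIVE at the odd `p`, `C • V^{(p*)} = W`, `Σ₀`/`Φ₀` data
on `W` (even line, non-trivial action, `χ_K`-twist ramified), `κ` cyclotomic with generator `γ`
matching the cyclotomic variable, `f` the newform of `V`, `B` a branch series of the telescope's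
reduction disjunction, `D` ANY `Λ`-dual datum of `Sel_{p^∞}(W/ℚ_∞)`, `ϖ` the period ratio: then
`X(W/ℚ_∞)` is torsion and `char_Λ X(W/ℚ_∞) = (g')` with `ι g' = u·ϖ·B`. Proof: eigen-descent
(`SelmerDualData.exists_chiEigenInCyclotomic`) then §1 at `D'.toEigen` fed by `hAlgW` at `D`.
[cite: GreenbergLNM1716, §5 (PDF p. 143)] [cite: Wuthrich2014, Thm. 16 (p. 397)]
[cite: Delbourgo1998, Main Conjecture (p. 151)] [cite: GreenbergVatsal2000, §2 (16), §3 pp. 38–39 (shape only)] -/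
theorem X3Branch.charIdeal_eq_span_of_multBranchCongruence_of_algebraicCountW
    (hW16 : Wuthrich2014.thm16_halfEigenCharIdeal_dvd_cyclotomicPrime)
    (hGVM : ∀ (V : WeierstrassCurve ℚ) [V.IsGloballyMinimal] [V.IsElliptic]
      (W : WeierstrassCurve ℚ) [W.IsGloballyMinimal] [W.IsElliptic] (p : ℕ) [Fact p.Prime]
      (K : Type) [Field K] [NumberField K] [(galRange (K := ℚ) K).Normal]
      (κ : ZpExtension ℚ p) {N : ℕ} [NeZero N] (f : CuspForm (Gamma0 N) 2) (B : PowerSeries ℚ_[p])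
      (S₀ : Finset (HeightOneSpectrum (𝓞 ℚ)))
      (Φ₀ : AddSubgroup (W.geomTorsion (p : ℤ))) (hΦ : IsRationalLine W p Φ₀),
      p ≠ 2 → V.HasMultiplicativeReductionAtPrime p → ¬ V.HasIrreducibleModPGaloisRep p →
      Module.finrank ℚ K = 2 → (∃ θ : K, θ ^ 2 = algebraMap ℚ K ((-1) ^ (p / 2) * p)) →
      (∃ C : VariableChange ℚ, C • V.quadraticTwist ((-1) ^ (p / 2) * p : ℚ) = W) →
      κ.IsCyclotomic →
      ((IsOrdinaryAt V p ∧
          B = if Even (p / 2) then padicLFunctionBranch f ((unitRoot V p : ℤ_[p]) : ℚ_[p]) (p / 2)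
            else padicLFunctionMinusBranch f ((unitRoot V p : ℤ_[p]) : ℚ_[p]) (p / 2)) ∨
        (V.HasSplitMultiplicativeReductionAtPrime p ∧
          B = if Even (p / 2) then padicLFunctionPlusBranchMult f (1 : ℚ_[p]) (p / 2)
            else padicLFunctionMinusBranchMult f (1 : ℚ_[p]) (p / 2)) ∨
        (V.HasMultiplicativeReductionAtPrime p ∧ ¬ V.HasSplitMultiplicativeReductionAtPrime p ∧
          B = if Even (p / 2) then padicLFunctionPlusBranchMult f (-1 : ℚ_[p]) (p / 2)
            else padicLFunctionMinusBranchMult f (-1 : ℚ_[p]) (p / 2))) →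
      IsNewformOf V f → LineEven W p Φ₀ →
      (∃ (σ : absoluteGaloisGroup ℚ) (P : W.geomTorsion (p : ℤ)), P ∈ Φ₀ ∧ σ • P ≠ P) →
      (¬ ∀ v : HeightOneSpectrum (𝓞 ℚ), ((p : ℕ) : 𝓞 ℚ) ∈ v.asIdeal →
          ∀ 𝔓 ∈ v.primesAbove, ∀ σ ∈ 𝔓.inertia (absoluteGaloisGroup ℚ), ∀ P ∈ Φ₀,
            σ • P = (if σ ∈ galRange (K := ℚ) K then P else -P)) →
      (∀ v ∈ S₀, ((p : ℕ) : 𝓞 ℚ) ∉ v.asIdeal) →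
      (∀ v : HeightOneSpectrum (𝓞 ℚ), v ∉ S₀ → ((p : ℕ) : 𝓞 ℚ) ∉ v.asIdeal →
        W.HasGoodReductionAt v) →
      ∀ (ϖ : ℚ), (if Even (p / 2) then (ϖ : ℝ) * V.realPeriodRat = plusPeriod f
          else (ϖ : ℝ) * V.imaginaryPeriodRat = minusPeriod f) →
      ∀ (b : IwasawaAlgebra p) (u : ℤ_[p]ˣ),
        iwasawaToPowerSeries p b = PowerSeries.C ((((u : ℤ_[p]) : ℚ_[p])) * ((ϖ : ℚ) : ℚ_[p])) * B →
        HasUnitContent (b * eulerFactorProduct W p S₀) ∧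
          p ^ (PowerSeries.map (PadicInt.toZMod (p := p)) (b * eulerFactorProduct W p S₀)).order.toNat =
            Nat.card (residualLineH1 W p κ S₀ Φ₀ hΦ) * Nat.card (residualQuotSelmer W p κ S₀ Φ₀ hΦ))
    (hp2 : p ≠ 2) (hmult : Mult V p) {C : VariableChange ℚ}
    (hC : C • V.quadraticTwist ((-1) ^ (p / 2) * p : ℚ) = W)
    (S₀ : Finset (HeightOneSpectrum (𝓞 ℚ))) (hS₀ : ∀ v ∈ S₀, ((p : ℕ) : 𝓞 ℚ) ∉ v.asIdeal)
    (hS : ∀ v : HeightOneSpectrum (𝓞 ℚ), v ∉ S₀ → ((p : ℕ) : 𝓞 ℚ) ∉ v.asIdeal →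
      W.HasGoodReductionAt v)
    (Φ₀ : AddSubgroup (W.geomTorsion (p : ℤ))) (hΦ : IsRationalLine W p Φ₀)
    (heven : LineEven W p Φ₀)
    (hnt : ∃ (σ : absoluteGaloisGroup ℚ) (P : W.geomTorsion (p : ℤ)), P ∈ Φ₀ ∧ σ • P ≠ P)
    (hram : ∀ (K : Type) [Field K] [NumberField K] [(galRange (K := ℚ) K).Normal],
      Module.finrank ℚ K = 2 → (∃ θ : K, θ ^ 2 = algebraMap ℚ K ((-1) ^ (p / 2) * p)) →
      ¬ ∀ v : HeightOneSpectrum (𝓞 ℚ), ((p : ℕ) : 𝓞 ℚ) ∈ v.asIdeal →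
        ∀ 𝔓 ∈ v.primesAbove, ∀ σ ∈ 𝔓.inertia (absoluteGaloisGroup ℚ), ∀ P ∈ Φ₀,
          σ • P = (if σ ∈ galRange (K := ℚ) K then P else -P))
    (hAlgW : ∀ {κ : ZpExtension ℚ p} {γ : Field.absoluteGaloisGroup ℚ} (D : W.SelmerDualData κ γ)
      (g : IwasawaAlgebra p), κ.IsCyclotomic → κ.IsTopGenerator γ →
      D.charIdeal = Ideal.span {g} → HasUnitContent g →
        p ^ (lam g + ∑ v ∈ S₀, delta W p v) =
          Nat.card (residualLineH1 W p κ S₀ Φ₀ hΦ) * Nat.card (residualQuotSelmer W p κ S₀ Φ₀ hΦ))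
    {κ : ZpExtension ℚ p} {γ : Field.absoluteGaloisGroup ℚ} {N : ℕ} [NeZero N]
    {f : CuspForm (Gamma0 N) 2} {B : PowerSeries ℚ_[p]}
    (hκ : κ.IsCyclotomic) (hγ : κ.IsTopGenerator γ) (hcv : IsCyclotomicVariable p γ)
    (hf : IsNewformOf V f)
    (hred : ((IsOrdinaryAt V p ∧
        B = if Even (p / 2) then padicLFunctionBranch f ((unitRoot V p : ℤ_[p]) : ℚ_[p]) (p / 2)
          else padicLFunctionMinusBranch f ((unitRoot V p : ℤ_[p]) : ℚ_[p]) (p / 2)) ∨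
      (V.HasSplitMultiplicativeReductionAtPrime p ∧
        B = if Even (p / 2) then padicLFunctionPlusBranchMult f (1 : ℚ_[p]) (p / 2)
          else padicLFunctionMinusBranchMult f (1 : ℚ_[p]) (p / 2)) ∨
      (V.HasMultiplicativeReductionAtPrime p ∧ ¬ V.HasSplitMultiplicativeReductionAtPrime p ∧
        B = if Even (p / 2) then padicLFunctionPlusBranchMult f (-1 : ℚ_[p]) (p / 2)
          else padicLFunctionMinusBranchMult f (-1 : ℚ_[p]) (p / 2))))
    (D : W.SelmerDualData κ γ) (ϖ : ℚ)
    (hϖ : if Even (p / 2) then (ϖ : ℝ) * V.realPeriodRat = plusPeriod f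
        else (ϖ : ℝ) * V.imaginaryPeriodRat = minusPeriod f) :
    D.IsTorsion ∧ ∃ g' : IwasawaAlgebra p, D.charIdeal = Ideal.span {g'} ∧ ∃ u : ℤ_[p]ˣ,
      iwasawaToPowerSeries p g' = PowerSeries.C (((u : ℤ_[p]) : ℚ_[p]) * (ϖ : ℚ_[p])) * B := by
  have hpS : ((-1 : ℚ) ^ (p / 2) * p) ≠ 0 := pStar_ne_zero p
  have hirr : ¬ V.HasIrreducibleModPGaloisRep p := fun hV ↦
    not_hasIrreducibleModPGaloisRep_of_isRationalLine hΦ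
      ((irr_iff_of_model_twist (W := V) (p := p) hpS ⟨C, hC⟩).mpr hV)
  haveI hcycL : IsCyclotomicExtension {p} ℚ (CyclotomicField p ℚ) := by
    have h : (CyclotomicField.algebra p ℚ : Algebra ℚ (CyclotomicField p ℚ)) =
        DivisionRing.toRatAlgebra := Subsingleton.elim _ _
    exact h ▸ CyclotomicField.isCyclotomicExtension p ℚ
  obtain ⟨K, θ, hK2, hθ, hθ2⟩ := exists_intermediateField_sq_eq_pStar p (CyclotomicField p ℚ) hp2
  haveI : NumberField K := NumberField.of_module_finite ℚ K
  haveI : IsGalois ℚ K := isGalois_of_finrank_eq_two K hK2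
  haveI := normal_galRange K hK2 (sigmaQ_ne_one K hK2 hθ hθ2)
  haveI := normal_galRange_cyclotomic p (CyclotomicField p ℚ)
  haveI : (V.quadraticTwist ((-1 : ℚ) ^ (p / 2) * p)).IsElliptic := V.isElliptic_quadraticTwist hpS
  obtain ⟨γ', hγ'KF, hκγ', ⟨g₀, hg₀, hγ'eq⟩, D', hchar, htor⟩ :=
    SelmerDualData.exists_chiEigenInCyclotomic p (CyclotomicField p ℚ) V K hK2 hθ hθ2 κ hC hp2 D
  have key := X3Branch.charIdeal_eq_span_of_multBranchCongruence_of_count (V := V) (W := W) hW16 hGVM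
    hmult ⟨C, hC⟩ S₀ hS₀ hS Φ₀ hΦ heven hnt K (CyclotomicField p ℚ) (κ := κ) (γ := γ') (f := f)
    (B := B) hp2 hK2 ⟨θ, hθ2⟩ hred (hram K hK2 ⟨θ, hθ2⟩) hirr hκ (isTopGenerator_of_kappa_eq κ hκγ' hγ)
    (isCyclotomicVariable_of_eq_mul p κ hκ hg₀ hγ'eq hcv)
    (Subgroup.mem_inf.mp hγ'KF).1 (Subgroup.mem_inf.mp hγ'KF).2 hf
    (ChiEigenSelmerInDualData.toEigen V K κ (galRange (K := ℚ) (CyclotomicField p ℚ)) γ' D') ϖ hϖ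
    (fun g hg hμ ↦ hAlgW D g hκ hγ (hchar ▸ hg) hμ)
  obtain ⟨htors', g', hchar', u, hι⟩ := key
  exact ⟨htor.mp htors', g', hchar ▸ hchar', u, hι⟩

end Descent

end Summit.BirchSwinnertonDyer.Rank1Residual.Additive

end
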